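import Summits.SmoothPoincare4.SmoothPoincare4.Theorems.DottedCircleRasmussenDcrGapHelperFriendsCarrierVkPartCFormulas

/-!
# Helper `helper_friendsCarrier_Vk_partC` (V_k part C: the collar of the uninverted model disc exterior) —
# piece 4: `collar ∘ collarInv = id` on the collar region; the image of the collar
(item stmt-SmoothPoincare4-16128, route route-SmoothPoincare4-DottedCircleRasmussen)

Fourth piece of the port of the tree's `SliceDiscEndCollar.lean` to `M_k ⊂ ℝ⁴` (definitions in
`…VkPartCDatum`; `…VkPartCChart`, `…VkPartCFormulas`).  The template's compact core
`B̄(0, 1 - s₀) ∖ G(D̊² × B(0,1))` has no analogue in `ℝ⁴ ∖ D_k` (the exterior is not a ball); instead the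
COLLAR REGION is described directly,

  `region = (Φ((0, s₀) × M_k) ∖ Δ) ∪ G(D̊² × (B(0,1) ∖ 0))`

(thin shell off the disc, punctured unit tube of the open disc), and this file proves

* `collar ∘ collarInv = id` on the region (`Pres.collar_collarInv`), branch by branch: the profile
  coordinates `(1 - ‖x‖, ‖w‖)` of a region point `G(x, w)` lie in the L-shaped domain `P(s₀)` (the deep
  tube misses the thin shell), a region point outside the shell region lies in the tube neighbourhood;
* the collar takes values in the region (`Pres.collar_mem_region`; a disc point in the thin shell drops to
  the knot), hence `range collar = region` (`Pres.range_collar`), the region is open and lies in the exterior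
  `O = ℝ⁴ ∖ (D_k ∪ Δ)`;
* `helper_friendsCarrier_Vk_partC_range` — the registered summary (the collar is a bijection of `Y × ℝ` onto
  an open subset of the exterior).

Everything is proved; no definitions, no named facts, no `sorry`.
References: Manolescu–Piccirillo (2023), §3.2 [ManolescuPiccirillo2023]; Kirby (1989), Ch. I §5 [Kirby1989].
-/

-- the prescribed namespace `Summit.<P>.<Sub>.…` duplicates `SmoothPoincare4` (P = Sub)
set_option linter.dupNamespace false
set_option linter.style.longLine false

noncomputable section

open scoped Manifold ContDiff Topology
open Function Set Metric
open Literature.Topology.FourManifolds Literature.Topology.FourManifolds.MMSW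

namespace Summit.SmoothPoincare4.SmoothPoincare4.Theorems.DcrGap.MkFriends

namespace FriendsVk

namespace CollarDatum

variable {k : ℕ} (V : CollarDatum k)

/-! ### The collar region -/

/-- The region misses the disc. [folklore] -/
theorem not_mem_disc_of_mem_region {z : EuclideanSpace ℝ (Fin 4)} (hz : z ∈ V.region) : z ∉ V.disc := by
  rcases hz with ⟨-, h⟩ | ⟨⟨x, w⟩, ⟨hx, hw, hw0⟩, rfl⟩
  · exact h
  · rw [mem_ball, dist_zero_right] at hx hw
    exact V.G_not_mem_disc hx (hw.trans one_lt_two) hw0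

/-- The region misses `D_k`. [folklore] -/
theorem not_mem_modelHandlebody_of_mem_region {z : EuclideanSpace ℝ (Fin 4)} (hz : z ∈ V.region) : z ∉ modelHandlebody k := by
  rcases hz with ⟨h, -⟩ | ⟨⟨x, w⟩, ⟨hx, hw, -⟩, rfl⟩
  · exact V.not_mem_modelHandlebody_of_mem_shell h
  · rw [mem_ball, dist_zero_right] at hx hw
    exact V.not_mem _ ⟨by simpa using hx, by rw [mem_ball, dist_zero_right]; exact hw.trans one_lt_two⟩

/-- **The region lies in the exterior** `O = ℝ⁴ ∖ (D_k ∪ Δ)`. [folklore] -/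
theorem region_subset_O : V.region ⊆ V.O := fun _ hz =>
  ⟨V.not_mem_modelHandlebody_of_mem_region hz, V.not_mem_disc_of_mem_region hz⟩

/-- The punctured unit tube of the open disc is open. [folklore] -/
theorem isOpen_image_punctured : IsOpen (V.G '' (ball (0 : EuclideanSpace ℝ (Fin 2)) 1 ×ˢ (ball (0 : EuclideanSpace ℝ (Fin 2)) 1 \ {0}))) :=
  V.isOpen_image (isOpen_ball.prod (isOpen_ball.sdiff isClosed_singleton)) fun q hq =>
    ConicalDiscTube.mem_dom_iff.2 ⟨by simpa using hq.1, by
      have := hq.2.1; rw [mem_ball, dist_zero_right] at this; exact this.trans one_lt_two⟩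

/-- **The region is open.** [folklore] -/
theorem isOpen_region : IsOpen V.region :=
  ((V.isOpen_shell V.s₀).inter V.isClosed_disc.isOpen_compl).union V.isOpen_image_punctured

/-! ### Profile coordinates of region points -/

/-- A tube point of the region over the deep disc has normal radius `< 1`. [folklore] -/
theorem norm_snd_lt_one {q : (EuclideanSpace ℝ (Fin 2)) × (EuclideanSpace ℝ (Fin 2))}
    (hq : q ∈ (ConicalDiscTube.dom : Set ((EuclideanSpace ℝ (Fin 2)) × (EuclideanSpace ℝ (Fin 2))))) (hreg : V.G q ∈ V.region)
    (hx : ‖q.1‖ ≤ 1 - V.s₀) : ‖q.2‖ < 1 := by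
  obtain ⟨x, w⟩ := q
  rcases hreg with ⟨hshell, -⟩ | ⟨q', hq', heq⟩
  · exact absurd hshell (V.G_not_mem_shell hx (ConicalDiscTube.mem_dom_iff.1 hq).2)
  · obtain ⟨hx', hw', -⟩ := hq'
    rw [mem_ball, dist_zero_right] at hx' hw'
    have := V.injOn (ConicalDiscTube.mem_dom_iff.2 ⟨hx', hw'.trans one_lt_two⟩) hq heq
    rw [← this]; exact hw'

/-- A tube point off the disc has nonzero normal coordinate. [folklore] -/
theorem snd_ne_zero_of_not_mem_disc {q : (EuclideanSpace ℝ (Fin 2)) × (EuclideanSpace ℝ (Fin 2))}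
    (hq : q ∈ (ConicalDiscTube.dom : Set ((EuclideanSpace ℝ (Fin 2)) × (EuclideanSpace ℝ (Fin 2))))) (hdisc : V.G q ∉ V.disc) : q.2 ≠ 0 := by
  intro h
  obtain ⟨x, w⟩ := q
  simp only at h; subst h
  exact hdisc (V.G_zero_mem_disc (ConicalDiscTube.mem_dom_iff.1 hq).1)

/-- **The profile coordinates of a region point in the tube lie in `P s₀`.** [folklore] -/
theorem mem_P_of_region {q : (EuclideanSpace ℝ (Fin 2)) × (EuclideanSpace ℝ (Fin 2))}
    (hq : q ∈ (ConicalDiscTube.dom : Set ((EuclideanSpace ℝ (Fin 2)) × (EuclideanSpace ℝ (Fin 2))))) (hx : q.1 ≠ 0)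
    (hreg : V.G q ∈ V.region) : (1 - ‖q.1‖, ‖q.2‖) ∈ SliceCollar.P V.s₀ := by
  obtain ⟨h1, h2⟩ := ConicalDiscTube.mem_dom_iff.1 hq
  have hw := V.snd_ne_zero_of_not_mem_disc hq (V.not_mem_disc_of_mem_region hreg)
  refine SliceCollar.mem_P_iff.2 ⟨by simp only; linarith, by simp only; linarith [norm_pos_iff.2 hx], norm_pos_iff.2 hw, h2, ?_⟩
  simp only
  by_contra h
  rw [not_or, not_lt, not_lt] at h
  have := V.norm_snd_lt_one hq hreg (by linarith [h.1])
  linarith [h.2]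

/-- A region point outside the shell region lies in the tube neighbourhood `N`. [folklore] -/
theorem mem_N_of_region {z : EuclideanSpace ℝ (Fin 4)} (hz : z ∈ V.region) (hrad : z ∉ V.radSetT) : z ∈ V.N := by
  rcases hz with ⟨hshell, -⟩ | ⟨q, hq, rfl⟩
  · -- a shell point whose drop is in the unit tube: a flow point of the tube
    have hdir : V.drop z ∈ V.unitTube := by
      by_contra h; exact hrad ⟨hshell, h⟩
    obtain ⟨⟨u, w⟩, ⟨-, hw⟩, hq⟩ := hdir
    rw [mem_closedBall, dist_zero_right] at hw
    obtain ⟨hband, hd0, hds⟩ := hshell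
    refine ⟨((1 - depth k z) • (u : EuclideanSpace ℝ (Fin 2)), w), ConicalDiscTube.mem_dom_iff.2 ⟨?_, by simp only; linarith⟩, ?_⟩
    · simp only; rw [norm_smul_coe_sphere (by linarith [V.s₀_lt_two, V.two_le_half])]; linarith
    · rw [V.cone u (1 - depth k z) w (by linarith [V.s₀_lt]) (by linarith) (by linarith), sub_sub_cancel]
      show V.Φ (depth k z, V.ν (u, w)) = z
      rw [hq, V.Φ_depth_drop hband]
  · exact ⟨q, ConicalDiscTube.mem_dom_iff.2 ⟨by simpa using hq.1, by
      have := hq.2.1; rw [mem_ball, dist_zero_right] at this; exact this.trans one_lt_two⟩, rfl⟩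

/-! ### `collar ∘ collarInv = id` on the collar region -/

namespace Pres

variable {V} {Y : Type*} [TopologicalSpace Y] [ChartedSpace (EuclideanSpace ℝ (Fin 3)) Y] (Q : V.Pres Y)

/-- **Branch R'**: `collar (collarInv z) = z` on the shell region. [folklore] -/
theorem collar_collarInv_rad {z : EuclideanSpace ℝ (Fin 4)} (hz : z ∈ V.radSetT) : V.collar Q.jM Q.jB Q.ψ (V.collarInv Q.jM Q.jB z) = z := by
  obtain ⟨⟨hband, hd0, hds⟩, hdir⟩ := hz
  have hdrop : V.drop z ∈ modelBoundary k := V.drop_mem hband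
  rw [V.collarInv_of_mem_radSetT ⟨⟨hband, hd0, hds⟩, hdir⟩, CollarDatum.ΨRad, Q.collar_of_not_mem_unitTube hdrop hdir, CollarDatum.cRad]
  simp only [neg_neg]
  rw [Real.exp_log (SliceCollar.E_pos V.s₀_pos hd0 hds), SliceCollar.Einv_E V.s₀_pos hd0 hds, V.Φ_depth_drop hband]

/-- **Branch P'**: `collar (collarInv z) = z` in the tube, off the centre fibre. [folklore] -/
theorem collar_collarInv_tube {z : EuclideanSpace ℝ (Fin 4)} (hz : z ∉ V.radSetT) (hN : z ∈ V.N) (hx : (V.Ginv z).1 ≠ 0)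
    (hreg : z ∈ V.region) : V.collar Q.jM Q.jB Q.ψ (V.collarInv Q.jM Q.jB z) = z := by
  have hq := V.Ginv_mem hN
  have hGz := V.G_Ginv hN
  set x := (V.Ginv z).1 with hxdef
  set w := (V.Ginv z).2 with hwdef
  have hqeq : V.Ginv z = (x, w) := rfl
  rw [hqeq] at hq hGz
  obtain ⟨hx1, hw2⟩ := ConicalDiscTube.mem_dom_iff.1 hq
  have hw : w ≠ 0 := V.snd_ne_zero_of_not_mem_disc hq (by rw [hGz]; exact V.not_mem_disc_of_mem_region hreg)
  have hwpos : 0 < ‖w‖ := norm_pos_iff.2 hw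
  have hxpos : 0 < ‖x‖ := norm_pos_iff.2 hx
  set p : ℝ × ℝ := (1 - ‖x‖, ‖w‖) with hpdef
  have hP : p ∈ SliceCollar.P V.s₀ := V.mem_P_of_region hq hx (by rw [hGz]; exact hreg)
  obtain ⟨hℓ0, hℓ1, hr0, hr2, hor⟩ := SliceCollar.mem_P_iff.1 hP
  have hτ := (SliceCollar.Ψ_mem_Strip hP).1
  have hτ0 : 0 < (SliceCollar.Ψ V.s₀ p).1 := hτ.1
  -- evaluate the inverse collar
  rw [V.collarInv_of_fst_ne_zero hz hx, CollarDatum.ΨTube, CollarDatum.profB, ← hxdef, ← hwdef, ← hpdef]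
  have hmemM : V.ν (radialProjection (spherePt 1) x, (SliceCollar.Ψ V.s₀ p).1 •
      ((radialProjection (spherePt 1) w : Metric.sphere (0 : EuclideanSpace ℝ (Fin 2)) 1) : EuclideanSpace ℝ (Fin 2))) ∈ modelBoundary k := V.ν_mem _
  have hnotK := V.ν_smul_not_mem_range hτ0.ne' (radialProjection (spherePt 1) x) (radialProjection (spherePt 1) w)
  by_cases h1 : (SliceCollar.Ψ V.s₀ p).1 ≤ 1
  · -- tube branch: `τ ≤ 1`
    have hmem : V.ν (radialProjection (spherePt 1) x, (SliceCollar.Ψ V.s₀ p).1 •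
        ((radialProjection (spherePt 1) w : Metric.sphere (0 : EuclideanSpace ℝ (Fin 2)) 1) : EuclideanSpace ℝ (Fin 2))) ∈ V.unitTube := by
      rw [V.mem_unitTube_iff, norm_smul_coe_sphere hτ0.le]; exact h1
    rw [Q.collar_of_mem_unitTube hmemM hnotK hmem, V.cTube_apply, V.baseP_apply, norm_smul_coe_sphere hτ0.le, Prod.mk.eta,
      SliceCollar.Ψinv_Ψ V.s₀_pos V.depth₀_lt_one hP, radialProjection_smul _ hτ0, CollarDatum.ptB]
    rw [← hGz]
    congr 1
    refine Prod.ext ?_ ?_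
    · show (1 - p.1) • ((radialProjection (spherePt 1) x : Metric.sphere (0 : EuclideanSpace ℝ (Fin 2)) 1) : EuclideanSpace ℝ (Fin 2)) = x
      rw [show p.1 = 1 - ‖x‖ from rfl, sub_sub_cancel, norm_smul_coe_radialProjection]
    · show p.2 • ((radialProjection (spherePt 1) w : Metric.sphere (0 : EuclideanSpace ℝ (Fin 2)) 1) : EuclideanSpace ℝ (Fin 2)) = w
      exact norm_smul_coe_radialProjection _ _
  · -- shell branch: `τ > 1` forces the right regime `r = τ ≥ 1`, `ℓ < s₀`
    rw [not_le] at h1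
    obtain ⟨hr1, hℓs, hΨeq⟩ := V.right_of_one_lt_τ hP h1
    have hτeq : (SliceCollar.Ψ V.s₀ p).1 = p.2 := congrArg Prod.fst hΨeq
    have hnot : V.ν (radialProjection (spherePt 1) x, (SliceCollar.Ψ V.s₀ p).1 •
        ((radialProjection (spherePt 1) w : Metric.sphere (0 : EuclideanSpace ℝ (Fin 2)) 1) : EuclideanSpace ℝ (Fin 2))) ∉ V.unitTube := by
      rw [V.mem_unitTube_iff, norm_smul_coe_sphere hτ0.le, not_le]; linarith
    rw [Q.collar_of_not_mem_unitTube hmemM hnot, CollarDatum.cRad, hτeq, hΨeq]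
    simp only [neg_neg]
    rw [Real.exp_log (SliceCollar.E_pos V.s₀_pos hℓ0 hℓs), SliceCollar.Einv_E V.s₀_pos hℓ0 hℓs,
      show p.1 = 1 - ‖x‖ from rfl, show p.2 = ‖w‖ from rfl, norm_smul_coe_radialProjection, ← hGz]
    exact (V.G_eq_Φ (by linarith [V.s₀_lt]) hx1 hw2).symm

/-- **Branch F'**: `collar (collarInv z) = z` on the centre fibre (normal rays over the disc centre). [folklore] -/
theorem collar_collarInv_flat {z : EuclideanSpace ℝ (Fin 4)} (hz : z ∉ V.radSetT) (hN : z ∈ V.N) (hx : (V.Ginv z).1 = 0)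
    (hreg : z ∈ V.region) : V.collar Q.jM Q.jB Q.ψ (V.collarInv Q.jM Q.jB z) = z := by
  have hq := V.Ginv_mem hN
  have hGz := V.G_Ginv hN
  have hw : (V.Ginv z).2 ≠ 0 := V.snd_ne_zero_of_not_mem_disc hq (by rw [hGz]; exact V.not_mem_disc_of_mem_region hreg)
  have hwpos : 0 < ‖(V.Ginv z).2‖ := norm_pos_iff.2 hw
  have hw1 : ‖(V.Ginv z).2‖ < 1 := V.norm_snd_lt_one hq (by rw [hGz]; exact hreg) (by rw [hx]; simp; linarith [V.depth₀_lt_one])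
  have hE : 0 < SliceCollar.E 1 ‖(V.Ginv z).2‖ := SliceCollar.E_pos one_pos hwpos hw1
  have hsolid : ((0 : EuclideanSpace ℝ (Fin 2)), radialProjection (spherePt 1) (V.Ginv z).2) ∈ solidTorus := by simp [mem_solidTorus_iff]
  rw [V.collarInv_of_fst_eq_zero hz hx, CollarDatum.ΨFlat, hx]
  simp only [smul_zero]
  rw [TubeNbhd.jBt_of_norm_lt Q.jB (by simp), Q.collar_of_core _ hsolid, CollarDatum.cFlat]
  simp only [smul_zero, neg_neg]
  rw [Real.exp_log hE, SliceCollar.Einv_E one_pos hwpos hw1, norm_smul_coe_radialProjection]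
  conv_rhs => rw [← hGz]
  rw [show V.Ginv z = ((V.Ginv z).1, (V.Ginv z).2) from rfl, hx]

/-- **`collar ∘ collarInv = id` on the collar region.** [folklore] -/
theorem collar_collarInv {z : EuclideanSpace ℝ (Fin 4)} (hz : z ∈ V.region) : V.collar Q.jM Q.jB Q.ψ (V.collarInv Q.jM Q.jB z) = z := by
  by_cases hrad : z ∈ V.radSetT
  · exact Q.collar_collarInv_rad hrad
  · have hN := V.mem_N_of_region hz hrad
    by_cases hx : (V.Ginv z).1 = 0
    · exact Q.collar_collarInv_flat hrad hN hx hz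
    · exact Q.collar_collarInv_tube hrad hN hx hz

end Pres

/-! ### The collar takes values in the collar region -/

/-- A disc point in the thin shell is a flow point of the knot: its drop is on the knot. [folklore] -/
theorem drop_mem_range_of_mem_disc {z : EuclideanSpace ℝ (Fin 4)} (hz : z ∈ V.disc) (hzs : z ∈ V.shell V.s₀) : V.drop z ∈ range V.K₁ := by
  obtain ⟨x, hx, rfl⟩ := hz
  rw [mem_closedBall, dist_zero_right] at hx
  rcases lt_or_ge ‖x‖ (1 - V.s₁) with hdeep | hband
  · -- deep disc points are off the thin shell
    rw [← V.apply_zero x (by simp; linarith [V.width_pos])] at hzs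
    exact absurd hzs (V.G_not_mem_shell (by linarith [V.s₀_lt]) (by simp))
  · -- band disc points are flow points of the knot
    have hx0 : x ≠ 0 := by
      rintro rfl; simp at hband; linarith [V.width_lt_one]
    have hcone : V.g x = V.Φ (1 - ‖x‖, V.K₁ (radialProjection (spherePt 1) x)) := by
      conv_lhs => rw [← norm_smul_coe_radialProjection (spherePt 1) x]
      exact V.g_cone _ _ hband hx
    have hs : |1 - ‖x‖| < 2 * V.ε := by rw [abs_of_nonneg (by linarith)]; linarith [V.s₁_lt]
    rw [hcone, V.drop_Φ (V.isModelKnot.mem _) hs]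
    exact mem_range_self _

/-- The shell formula takes values in the collar region. [folklore] -/
theorem cRad_mem_region {a : EuclideanSpace ℝ (Fin 4)} (ha : a ∈ modelBoundary k) (hat : a ∉ V.unitTube) (σ : ℝ) : V.cRad a σ ∈ V.region := by
  obtain ⟨-, hdrop, hshell⟩ := V.depth_drop_cRad ha σ
  refine Or.inl ⟨hshell, fun h => ?_⟩
  have := V.drop_mem_range_of_mem_disc h hshell
  rw [hdrop] at this
  exact hat (V.range_subset_unitTube this)

/-- The tube point over a point of the L-shaped domain lies in the collar region. [folklore] -/
theorem ptB_mem_region {p : ℝ × ℝ} (hp : p ∈ SliceCollar.P V.s₀) (u v : Metric.sphere (0 : EuclideanSpace ℝ (Fin 2)) 1) : V.ptB p.1 p.2 u v ∈ V.region := by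
  obtain ⟨hℓ0, hℓ1, hr0, hr2, hor⟩ := SliceCollar.mem_P_iff.1 hp
  have hr2' : |p.2| < 2 := by rw [abs_of_pos hr0]; exact hr2
  have hv0 : p.2 • (v : EuclideanSpace ℝ (Fin 2)) ≠ 0 := smul_ne_zero hr0.ne' (ne_zero_of_mem_unit_sphere v)
  rcases lt_or_ge p.2 1 with hr1 | hr1
  · -- normal radius `< 1`: inside the punctured unit tube of the open disc
    refine Or.inr ⟨((1 - p.1) • (u : EuclideanSpace ℝ (Fin 2)), p.2 • (v : EuclideanSpace ℝ (Fin 2))), ⟨?_, ?_, hv0⟩, rfl⟩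
    · rw [mem_ball, dist_zero_right, norm_smul_coe_sphere (by linarith)]; linarith
    · rw [mem_ball, dist_zero_right, norm_smul_coe_sphere hr0.le]; exact hr1
  · -- normal radius `≥ 1`: then `ℓ < s₀`, a flow point of the tube in the thin shell
    have hℓ : p.1 < V.s₀ := hor.resolve_right (not_lt.2 hr1)
    have hs : |p.1| < 2 * V.ε := by rw [abs_of_pos hℓ0]; linarith [V.s₀_lt_two]
    refine Or.inl ⟨?_, ?_⟩
    · rw [V.ptB_of_lt hℓ0 (hℓ.trans V.s₀_lt) hr2']
      exact (V.Φ_mem_shell_iff (V.ν_mem _) hs V.s₀).2 ⟨hℓ0, hℓ⟩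
    · rw [CollarDatum.ptB]
      exact V.G_not_mem_disc (by rw [norm_smul_coe_sphere (by linarith)]; linarith) (by rw [norm_smul_coe_sphere hr0.le]; exact hr2) hv0

/-- The tube formula takes values in the collar region. [folklore] -/
theorem cTube_mem_region {a : EuclideanSpace ℝ (Fin 4)} (ha' : a ∉ range V.K₁) (hat : a ∈ V.unitTube) (σ : ℝ) : V.cTube a σ ∈ V.region := by
  obtain ⟨⟨u, w⟩, ⟨-, hw1⟩, hqa⟩ := hat
  rw [mem_closedBall, dist_zero_right] at hw1
  have hw : w ≠ 0 := fun h => ha' (by rw [← hqa, h, V.ν_zero]; exact mem_range_self u)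
  rw [← hqa, V.cTube_apply]
  exact V.ptB_mem_region (V.baseP_mem hw (by linarith) σ) _ _

/-- The flat formula over the core circle takes values in the collar region. [folklore] -/
theorem cFlat_zero_mem_region (v : Metric.sphere (0 : EuclideanSpace ℝ (Fin 2)) 1) (σ : ℝ) : V.cFlat ((0 : EuclideanSpace ℝ (Fin 2)), v) σ ∈ V.region := by
  have hr := SliceCollar.Einv_mem one_pos (Real.exp (-σ))
  rw [CollarDatum.cFlat]
  simp only [smul_zero]
  refine Or.inr ⟨((0 : EuclideanSpace ℝ (Fin 2)), SliceCollar.Einv 1 (Real.exp (-σ)) • (v : EuclideanSpace ℝ (Fin 2))), ⟨by simp, ?_, ?_⟩, rfl⟩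
  · rw [mem_ball, dist_zero_right, norm_smul_coe_sphere hr.1.le]; exact hr.2
  · exact smul_ne_zero hr.1.ne' (ne_zero_of_mem_unit_sphere v)

namespace Pres

variable {V} {Y : Type*} [TopologicalSpace Y] [ChartedSpace (EuclideanSpace ℝ (Fin 3)) Y] (Q : V.Pres Y)

/-- **The collar takes values in the collar region.** [folklore] -/
theorem collar_mem_region (p : Y × ℝ) : V.collar Q.jM Q.jB Q.ψ p ∈ V.region := by
  obtain ⟨y, σ⟩ := p
  by_cases hy : y ∈ V.mSet Q.jM
  · obtain ⟨a, ⟨ha, ha'⟩, rfl⟩ := hy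
    by_cases hat : a ∈ V.unitTube
    · rw [Q.collar_of_mem_unitTube ha ha' hat]; exact V.cTube_mem_region ha' hat σ
    · rw [Q.collar_of_not_mem_unitTube ha hat]; exact V.cRad_mem_region ha hat σ
  · obtain ⟨v, h, rfl⟩ := Q.eq_jB_zero_of_not_mem hy
    rw [Q.collar_of_core v h]; exact V.cFlat_zero_mem_region v σ

/-- The collar takes values in the exterior. [folklore] -/
theorem collar_mem_O (p : Y × ℝ) : V.collar Q.jM Q.jB Q.ψ p ∈ V.O := V.region_subset_O (Q.collar_mem_region p)

/-- The inverse collar is injective on the collar region. [folklore] -/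
theorem collarInv_injOn : InjOn (V.collarInv Q.jM Q.jB) V.region :=
  fun z hz z' hz' h => by rw [← Q.collar_collarInv hz, ← Q.collar_collarInv hz', h]

/-- **The image of the collar is the collar region.** [folklore] -/
theorem range_collar : range (V.collar Q.jM Q.jB Q.ψ) = V.region := by
  refine Subset.antisymm ?_ fun z hz => ⟨_, Q.collar_collarInv hz⟩
  rintro _ ⟨p, rfl⟩; exact Q.collar_mem_region p

/-- Images of sets under the collar, through the inverse collar. [folklore] -/
theorem image_collar_eq (s : Set (Y × ℝ)) : V.collar Q.jM Q.jB Q.ψ '' s = {z | z ∈ V.region ∧ V.collarInv Q.jM Q.jB z ∈ s} := by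
  ext z
  constructor
  · rintro ⟨p, hp, rfl⟩
    exact ⟨Q.collar_mem_region p, by rwa [Q.collarInv_collar]⟩
  · rintro ⟨hz, hs⟩
    exact ⟨_, hs, Q.collar_collarInv hz⟩

end Pres

end CollarDatum

end FriendsVk

/-- **Helper `helper_friendsCarrier_Vk_partC_range`** (registered piece 4 of `helper_friendsCarrier_Vk_partC`,
line `mk_friends`, crux `DcrGap`): under the hypotheses of part C, the collar `c : Y × ℝ → ℝ⁴` of the
uninverted model disc exterior is a BIJECTION of `Y × ℝ` onto an OPEN subset of the exterior
`ℝ⁴ ∖ (D_k ∪ Δ)` — the thin shell `Φ((0, s₀) × M_k)` off the disc together with the punctured unit tube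
`G(D̊² × (B(0,1) ∖ 0))` of the open disc — with a two-sided inverse (Kirby 1989, Ch. I §5;
Manolescu–Piccirillo 2023, §3.2). [cite: Kirby1989, Ch. I §5] -/
theorem helper_friendsCarrier_Vk_partC_range : ∀ (k : ℕ) (K₁ : (sphere (0 : EuclideanSpace ℝ (Fin 2)) 1) → EuclideanSpace ℝ (Fin 4)) (Φ : ℝ × EuclideanSpace ℝ (Fin 4) → EuclideanSpace ℝ (Fin 4)) (ε s₁ s₀ : ℝ) (g : EuclideanSpace ℝ (Fin 2) → EuclideanSpace ℝ (Fin 4)) (G : EuclideanSpace ℝ (Fin 2) × EuclideanSpace ℝ (Fin 2) → EuclideanSpace ℝ (Fin 4)) (ν : (sphere (0 : EuclideanSpace ℝ (Fin 2)) 1) × EuclideanSpace ℝ (Fin 2) → EuclideanSpace ℝ (Fin 4)), IsModelKnot k K₁ → ContDiff ℝ ∞ Φ → (∀ x, Φ (0, x) = x) → (∀ s t x, Φ (s, Φ (t, x)) = Φ (s + t, x)) → 0 < ε → ε ≤ 1 / 4 → (∀ x ∈ modelBoundary k, ∀ s : ℝ, |s| ≤ 2 * ε → (∀ j, (1 : ℝ)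 / 2 < holeTerm k j (Φ (s, x))) ∧ levelFun k (Φ (s, x)) = 1 + s) → (∀ y, (∀ j, 0 < holeTerm k j y) → |levelFun k y - 1| < 2 * ε → Φ (1 - levelFun k y, y) ∈ modelBoundary k) → 0 < s₀ → s₀ < s₁ → s₁ < 2 * ε → IsModelSliceDisc k K₁ g → (∀ (u : (sphere (0 : EuclideanSpace ℝ (Fin 2)) 1)) (t : ℝ), 1 - s₁ ≤ t → t ≤ 1 → g (t • (u : EuclideanSpace ℝ (Fin 2))) = Φ (1 - t, K₁ u)) → (ContDiffOn ℝ ∞ G (ball 0 1 ×ˢ ball 0 2) ∧ InjOn G (ball 0 1 ×ˢ ball 0 2) ∧ (∀ q ∈ ball 0 1 ×ˢ ball 0 2, Injective (fderiv ℝ G q)) ∧ (∀ q ∈ ball 0 1 ×ˢ ball 0 2, G q ∉ modelHandlebody k) ∧ (∀ x ∈ ball 0 1, G (x, 0) = g x)) → (∀ (u : (sphere (0 : EuclideanSpace ℝ (Fin 2)) 1)) (t : ℝ) (w : EuclideanSpace ℝ (Fin 2)), 1 - s₁ < t → t < 1 → ‖w‖ < 2 → G (t • (u : EuclideanSpace ℝ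 (Fin 2)), w) = Φ (1 - t, ν (u, w))) → (∀ (x w : EuclideanSpace ℝ (Fin 2)), ‖x‖ ≤ 1 - s₀ → ‖w‖ < 2 → ∀ a ∈ modelBoundary k, ∀ s : ℝ, 0 < s → s < s₀ → G (x, w) ≠ Φ (s, a)) → ∀ (Y : Type) [TopologicalSpace Y] [T2Space Y] [SecondCountableTopology Y] [ChartedSpace (EuclideanSpace ℝ (Fin 3)) Y] [IsManifold (𝓡 3) ∞ Y] (jB : solidTorus → Y) (jM : EuclideanSpace ℝ (Fin 4) → Y) (W : Set (EuclideanSpace ℝ (Fin 4))) (ψ : Y → EuclideanSpace ℝ (Fin 4)), (Manifold.IsSmoothEmbedding (𝓘(ℝ, EuclideanSpace ℝ (Fin 2)).prod (𝓡 1)) (𝓡 3) ∞ jB ∧ IsOpen (range jB) ∧ ContMDiff ((𝓡 1).prod 𝓘(ℝ, EuclideanSpace ℝ (Fin 2))) 𝓘(ℝ, EuclideanSpace ℝ (Fin 4)) ∞ ν ∧ Injective ν ∧ (∀ p, Injective (mfderiv ((𝓡 1).prod 𝓘(ℝ, EuclideanSpace ℝ (Fin 2))) 𝓘(ℝ, EuclideanSpace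 ℝ (Fin 4)) ν p)) ∧ (∀ p, ν p ∈ modelBoundary k) ∧ (∀ u : (sphere (0 : EuclideanSpace ℝ (Fin 2)) 1), ν (u, 0) = K₁ u) ∧ IsOpen W ∧ (∀ x ∈ modelBoundary k, x ∉ range K₁ → x ∈ W) ∧ ContMDiffOn 𝓘(ℝ, EuclideanSpace ℝ (Fin 4)) (𝓡 3) ∞ jM W ∧ IsOpen (jM '' {x : EuclideanSpace ℝ (Fin 4) | x ∈ modelBoundary k ∧ x ∉ range K₁}) ∧ ContMDiffOn (𝓡 3) 𝓘(ℝ, EuclideanSpace ℝ (Fin 4)) ∞ ψ (jM '' {x : EuclideanSpace ℝ (Fin 4) | x ∈ modelBoundary k ∧ x ∉ range K₁}) ∧ (∀ x ∈ modelBoundary k, x ∉ range K₁ → ψ (jM x) = x) ∧ jM '' {x : EuclideanSpace ℝ (Fin 4) | x ∈ modelBoundary k ∧ x ∉ range K₁} ∪ range jB = univ ∧ (∀ x ∈ modelBoundary k, x ∉ range K₁ → ∀ b : solidTorus, jM x = jB b ↔ ∃ (u : (sphere (0 : EuclideanSpace ℝ (Fin 2)) 1)) (t : ℝ), t ∈ Ioo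 (0 : ℝ) 1 ∧ b.1.1 = t • (u : EuclideanSpace ℝ (Fin 2)) ∧ x = ν (u, t • (b.1.2 : EuclideanSpace ℝ (Fin 2))))) → ∃ (c : Y × ℝ → EuclideanSpace ℝ (Fin 4)) (cInv : EuclideanSpace ℝ (Fin 4) → Y × ℝ), IsOpen (range c) ∧ (∀ z ∈ range c, z ∉ modelHandlebody k ∧ z ∉ g '' closedBall 0 1) ∧ (∀ p, cInv (c p) = p) ∧ (∀ z ∈ range c, c (cInv z) = z) := by
  intro k K₁ Φ ε s₁ s₀ g G ν hK hΦ hΦ0 hΦadd hε hε4 hclock hband hs₀ hs₀₁ hs₁ε hg hgcone hG hGcone hdeep Y _ _ _ _ _ jB jM W ψ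
    ⟨h1, h2, h3, h4, h5, h6, h7, h8, h9, h10, h11, h12, h13, h14, h15⟩
  let V : FriendsVk.CollarDatum k :=
    FriendsVk.CollarDatum.datumOf hK hΦ hΦ0 hΦadd hε hε4 hclock hband hs₀ hs₀₁ hs₁ε hg hgcone hG hGcone hdeep h3 h4 h5 h6 h7
  obtain ⟨Q, hQM, hQB, hQψ⟩ := FriendsVk.CollarDatum.Pres.ofHyp_spec V h1 h2 h8 h9 h10 h11 h12 h13 h14 h15
  refine ⟨V.collar Q.jM Q.jB Q.ψ, V.collarInv Q.jM Q.jB, ?_, ?_, Q.collarInv_collar, ?_⟩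
  · rw [Q.range_collar]; exact V.isOpen_region
  · rw [Q.range_collar]; exact fun z hz => V.region_subset_O hz
  · rw [Q.range_collar]; exact fun z hz => Q.collar_collarInv hz

end Summit.SmoothPoincare4.SmoothPoincare4.Theorems.DcrGap.MkFriends

end
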